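import Mathlib

/-!
# `DivisionGap.PerMultiplesHard` (stmt-ValiantsHypothesis-5068), line `uncharged-face-walk`:
stub `stub_swapRepair` — value swaps kill bad positions one at a time

Let `X ⊆ Fin a × Fin a`, let `t` be a threshold, and suppose that every row `x` has at most
`e` rows `y ≠ x` of codegree `codeg(x, y) = #{z : (x, z) ∈ X ∧ (y, z) ∈ X} < t`, where
`4e + 8 ≤ a`.  For an order `ρ ∈ Perm (Fin a)` call a position `k` BAD if
`codeg(ρ k, ρ (k - 1)) < t`, where `k - 1 := (finRotate a)⁻¹ k` is the cyclic predecessor.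
Then every `ρ` can be changed into an order `ρ'` with NO bad position such that the
consecutive value pairs `(ρ' k, ρ' (k - 1))` differ from those of `ρ` at no more than
`4 · #bad(ρ)` positions.

Proof (elementary, Mathlib only).  Everything except the symmetry of the codegree
(`codeg_comm`) is proved for an arbitrary symmetric weight `cd : Fin a → Fin a → ℕ` in place
of the codegree.  Induction on `#bad(ρ)` (`repair`).  If there is no bad position take `ρ' = ρ`.
Otherwise take a bad position `p` and choose a position `z ∉ {p - 1, p, p + 1}` with
`cd(ρ z, ρ (p - 1)) ≥ t`, `cd(ρ (p + 1), ρ z) ≥ t`, `cd(ρ p, ρ (z - 1)) ≥ t` and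
`cd(ρ (z + 1), ρ p) ≥ t`: each of the four conditions excludes at most `e + 1` positions
(`cd` is symmetric, and `ρ`, `k ↦ k ± 1` are bijections), so together with the three forbidden
positions at most `4e + 7 < a` positions are excluded
(`Finset.exists_mem_notMem_of_card_lt_card`).  Swapping the VALUES at `p` and `z`, i.e.
passing to `ρ * Equiv.swap p z`, makes the positions `p, p + 1, z, z + 1` good and changes no
other consecutive pair; hence `bad(ρ * swap p z) ⊆ bad(ρ) \ {p}` and at most `4` consecutive
pairs changed (`swap_step`), and the induction hypothesis finishes, using the triangle
inclusion `changed_subset_union` for the changed positions.  The registered statement is the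
specialisation `cd := codeg` (definitional). [folklore]
-/

-- `Summit.ValiantsHypothesis.ValiantsHypothesis.…` is the tree's mandated layout (Sub = Summit).
set_option linter.dupNamespace false

noncomputable section

namespace Summit.ValiantsHypothesis.ValiantsHypothesis.Theorems.DivisionGap.PerMultiplesHard.SwapRepair

open Finset
open scoped BigOperators

variable {a : ℕ}

/-! ### The rotation `finRotate a` on values -/

/-- The value of the cyclic successor `finRotate a k`. -/
theorem val_finRotate (k : Fin a) :
    ((finRotate a k : Fin a) : ℕ) = if (k : ℕ) + 1 = a then 0 else (k : ℕ) + 1 := by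
  obtain ⟨n, rfl⟩ : ∃ n, a = n + 1 := ⟨a - 1, by have := k.pos; omega⟩
  rw [coe_finRotate]
  by_cases h : k = Fin.last n
  · rw [if_pos h, if_pos (by rw [h, Fin.val_last])]
  · have h' : (k : ℕ) ≠ n := fun h' => h (Fin.ext (by rw [h', Fin.val_last]))
    have h'' : ¬((k : ℕ) + 1 = n + 1) := by omega
    rw [if_neg h, if_neg h'']

/-- The value of the cyclic predecessor `(finRotate a).symm k`. -/
theorem val_finRotate_symm (k : Fin a) :
    (((finRotate a).symm k : Fin a) : ℕ) = if (k : ℕ) = 0 then a - 1 else (k : ℕ) - 1 := by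
  have h := val_finRotate ((finRotate a).symm k)
  rw [Equiv.apply_symm_apply] at h
  have h1 := ((finRotate a).symm k).isLt
  split_ifs at h <;> split_ifs <;> omega

/-- `k + 1 ≠ k` once `2 ≤ a`. -/
theorem finRotate_ne_self (ha : 2 ≤ a) (k : Fin a) : finRotate a k ≠ k := by
  intro h
  have h1 := congrArg Fin.val h
  rw [val_finRotate] at h1
  have h2 := k.isLt
  split_ifs at h1 <;> omega

/-- `k - 1 ≠ k` once `2 ≤ a`. -/
theorem finRotate_symm_ne_self (ha : 2 ≤ a) (k : Fin a) : (finRotate a).symm k ≠ k := by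
  intro h
  have h1 := congrArg Fin.val h
  rw [val_finRotate_symm] at h1
  have h2 := k.isLt
  split_ifs at h1 <;> omega

/-! ### Codegrees, low rows, changed positions -/

/-- The codegree `#{z : (x, z) ∈ X ∧ (y, z) ∈ X}` is symmetric in the two rows `x, y`. -/
theorem codeg_comm (X : Finset (Fin a × Fin a)) (x y : Fin a) :
    (univ.filter fun z : Fin a => (x, z) ∈ X ∧ (y, z) ∈ X).card =
      (univ.filter fun z : Fin a => (y, z) ∈ X ∧ (x, z) ∈ X).card := by
  congr 1
  ext z
  simp only [mem_filter, mem_univ, true_and]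
  exact and_comm

/-- Outside `x` and the rows of low weight with `x`, the weight with `x` is at least `t`. -/
theorem le_of_notMem_insert {cd : Fin a → Fin a → ℕ} {t : ℕ} {x y : Fin a}
    (h : y ∉ insert x (univ.filter fun y : Fin a => y ≠ x ∧ cd x y < t)) : t ≤ cd x y := by
  rw [mem_insert, mem_filter, not_or] at h
  by_contra hlt
  exact h.2 ⟨mem_univ _, h.1, not_le.mp hlt⟩

/-- The triangle inclusion for the positions whose consecutive value pair changed. -/
theorem changed_subset_union (ρ₂ ρ₁ ρ₀ : Equiv.Perm (Fin a)) :
    (univ.filter fun k : Fin a =>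
        (ρ₂ k, ρ₂ ((finRotate a).symm k)) ≠ (ρ₀ k, ρ₀ ((finRotate a).symm k))) ⊆
      (univ.filter fun k : Fin a =>
          (ρ₂ k, ρ₂ ((finRotate a).symm k)) ≠ (ρ₁ k, ρ₁ ((finRotate a).symm k))) ∪
        (univ.filter fun k : Fin a =>
          (ρ₁ k, ρ₁ ((finRotate a).symm k)) ≠ (ρ₀ k, ρ₀ ((finRotate a).symm k))) := by
  intro k hk
  simp only [mem_union, mem_filter, mem_univ, true_and] at hk ⊢
  by_contra h
  rw [not_or, not_not, not_not] at h
  exact hk (h.1.trans h.2)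

/-! ### One swap -/

/-- **One swap.**  Let `cd` be a symmetric weight on pairs of rows such that every row `x` has
at most `e` rows `y ≠ x` of weight `cd x y < t`, and let `4e + 8 ≤ a`.  Then for every order
`ρ` and every position `p` there is an order `ρ₁` (namely `ρ * swap p z` for a suitable
position `z`) whose bad positions (`cd (ρ₁ k) (ρ₁ (k - 1)) < t`) are bad positions of `ρ`
other than `p`, and whose consecutive value pairs differ from those of `ρ` at no more than `4`
positions. -/
theorem swap_step {e t : ℕ} {cd : Fin a → Fin a → ℕ}
    (hcomm : ∀ x y : Fin a, cd x y = cd y x) (ha : 4 * e + 8 ≤ a)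
    (hX : ∀ x : Fin a, (univ.filter fun y : Fin a => y ≠ x ∧ cd x y < t).card ≤ e)
    (ρ : Equiv.Perm (Fin a)) (p : Fin a) :
    ∃ ρ₁ : Equiv.Perm (Fin a),
      (univ.filter fun k : Fin a => cd (ρ₁ k) (ρ₁ ((finRotate a).symm k)) < t) ⊆
        (univ.filter fun k : Fin a => cd (ρ k) (ρ ((finRotate a).symm k)) < t).erase p ∧
      (univ.filter fun k : Fin a =>
          (ρ₁ k, ρ₁ ((finRotate a).symm k)) ≠ (ρ k, ρ ((finRotate a).symm k))).card ≤
        4 := by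
  have ha2 : 2 ≤ a := by omega
  -- the three value sets to avoid, each of size `≤ e + 1`
  obtain ⟨S₀, hS₀⟩ : ∃ S : Finset (Fin a), S = insert (ρ ((finRotate a).symm p))
      (univ.filter fun y : Fin a =>
        y ≠ ρ ((finRotate a).symm p) ∧ cd (ρ ((finRotate a).symm p)) y < t) := ⟨_, rfl⟩
  obtain ⟨S₁, hS₁⟩ : ∃ S : Finset (Fin a),
      S = insert (ρ p) (univ.filter fun y : Fin a => y ≠ ρ p ∧ cd (ρ p) y < t) :=
    ⟨_, rfl⟩
  obtain ⟨S₂, hS₂⟩ : ∃ S : Finset (Fin a), S = insert (ρ (finRotate a p))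
      (univ.filter fun y : Fin a =>
        y ≠ ρ (finRotate a p) ∧ cd (ρ (finRotate a p)) y < t) := ⟨_, rfl⟩
  have hS₀c : S₀.card ≤ e + 1 :=
    hS₀ ▸ (card_insert_le _ _).trans (Nat.add_le_add_right (hX _) 1)
  have hS₁c : S₁.card ≤ e + 1 :=
    hS₁ ▸ (card_insert_le _ _).trans (Nat.add_le_add_right (hX _) 1)
  have hS₂c : S₂.card ≤ e + 1 :=
    hS₂ ▸ (card_insert_le _ _).trans (Nat.add_le_add_right (hX _) 1)
  -- the forbidden positions
  obtain ⟨U, hU⟩ : ∃ U : Finset (Fin a),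
      U = S₀.image ρ.symm ∪ S₂.image ρ.symm ∪
        S₁.image (fun y => finRotate a (ρ.symm y)) ∪
        S₁.image (fun y => (finRotate a).symm (ρ.symm y)) := ⟨_, rfl⟩
  have hUc : U.card ≤ 4 * e + 4 := by
    have i0 : (S₀.image ρ.symm).card ≤ e + 1 := card_image_le.trans hS₀c
    have i2 : (S₂.image ρ.symm).card ≤ e + 1 := card_image_le.trans hS₂c
    have i3 : (S₁.image (fun y => finRotate a (ρ.symm y))).card ≤ e + 1 :=
      card_image_le.trans hS₁c
    have i4 : (S₁.image (fun y => (finRotate a).symm (ρ.symm y))).card ≤ e + 1 :=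
      card_image_le.trans hS₁c
    have u1 := card_union_le (S₀.image ρ.symm) (S₂.image ρ.symm)
    have u2 := card_union_le (S₀.image ρ.symm ∪ S₂.image ρ.symm)
      (S₁.image (fun y => finRotate a (ρ.symm y)))
    have u3 := card_union_le
      (S₀.image ρ.symm ∪ S₂.image ρ.symm ∪ S₁.image (fun y => finRotate a (ρ.symm y)))
      (S₁.image (fun y => (finRotate a).symm (ρ.symm y)))
    rw [hU]
    omega
  have hFc : (insert ((finRotate a).symm p) (insert p (insert (finRotate a p) U))).card <
      (univ : Finset (Fin a)).card := by
    rw [card_univ, Fintype.card_fin]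
    have i1 := card_insert_le (finRotate a p) U
    have i2 := card_insert_le p (insert (finRotate a p) U)
    have i3 := card_insert_le ((finRotate a).symm p) (insert p (insert (finRotate a p) U))
    omega
  -- a surviving position `z` and its properties
  obtain ⟨z, -, hzF⟩ := exists_mem_notMem_of_card_lt_card hFc
  simp only [mem_insert, not_or] at hzF
  obtain ⟨hz1, -, hz3, hzU⟩ := hzF
  rw [hU] at hzU
  simp only [mem_union, not_or] at hzU
  obtain ⟨⟨⟨hA, hB⟩, hC⟩, hD⟩ := hzU
  have h1 : t ≤ cd (ρ z) (ρ ((finRotate a).symm p)) := by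
    rw [hcomm]
    refine le_of_notMem_insert fun h => hA (mem_image.mpr ⟨ρ z, hS₀ ▸ h, ?_⟩)
    exact ρ.symm_apply_apply z
  have h2 : t ≤ cd (ρ (finRotate a p)) (ρ z) := by
    refine le_of_notMem_insert fun h => hB (mem_image.mpr ⟨ρ z, hS₂ ▸ h, ?_⟩)
    exact ρ.symm_apply_apply z
  have h3 : t ≤ cd (ρ p) (ρ ((finRotate a).symm z)) := by
    refine le_of_notMem_insert fun h =>
      hC (mem_image.mpr ⟨ρ ((finRotate a).symm z), hS₁ ▸ h, ?_⟩)
    show finRotate a (ρ.symm (ρ ((finRotate a).symm z))) = z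
    rw [Equiv.symm_apply_apply, Equiv.apply_symm_apply]
  have h4 : t ≤ cd (ρ (finRotate a z)) (ρ p) := by
    rw [hcomm]
    refine le_of_notMem_insert fun h => hD (mem_image.mpr ⟨ρ (finRotate a z), hS₁ ▸ h, ?_⟩)
    show (finRotate a).symm (ρ.symm (ρ (finRotate a z))) = z
    rw [Equiv.symm_apply_apply, Equiv.symm_apply_apply]
  -- the swapped order
  obtain ⟨ρ₁, hρ₁⟩ : ∃ ρ₁ : Equiv.Perm (Fin a), ρ₁ = ρ * Equiv.swap p z :=
    ⟨_, rfl⟩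
  have e_p : ρ₁ p = ρ z := by rw [hρ₁, Equiv.Perm.mul_apply, Equiv.swap_apply_left]
  have e_z : ρ₁ z = ρ p := by rw [hρ₁, Equiv.Perm.mul_apply, Equiv.swap_apply_right]
  have e_of : ∀ k, k ≠ p → k ≠ z → ρ₁ k = ρ k := fun k hk1 hk2 => by
    rw [hρ₁, Equiv.Perm.mul_apply, Equiv.swap_apply_of_ne_of_ne hk1 hk2]
  -- distinctness of the relevant positions
  have d1 : (finRotate a).symm p ≠ p := finRotate_symm_ne_self ha2 p
  have d2 : (finRotate a).symm p ≠ z := fun h => hz1 h.symm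
  have d3 : finRotate a p ≠ p := finRotate_ne_self ha2 p
  have d4 : finRotate a p ≠ z := fun h => hz3 h.symm
  have d5 : (finRotate a).symm z ≠ p := fun h => hz3 ((finRotate a).symm_apply_eq.mp h)
  have d6 : (finRotate a).symm z ≠ z := finRotate_symm_ne_self ha2 z
  have d7 : finRotate a z ≠ p := fun h => hz1 (by rw [← h, Equiv.symm_apply_apply])
  have d8 : finRotate a z ≠ z := finRotate_ne_self ha2 z
  -- the four repaired positions
  have g_p : t ≤ cd (ρ₁ p) (ρ₁ ((finRotate a).symm p)) := by
    rw [e_p, e_of _ d1 d2]; exact h1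
  have g_sp : t ≤ cd (ρ₁ (finRotate a p)) (ρ₁ ((finRotate a).symm (finRotate a p))) := by
    rw [e_of _ d3 d4, Equiv.symm_apply_apply, e_p]; exact h2
  have g_z : t ≤ cd (ρ₁ z) (ρ₁ ((finRotate a).symm z)) := by
    rw [e_z, e_of _ d5 d6]; exact h3
  have g_sz : t ≤ cd (ρ₁ (finRotate a z)) (ρ₁ ((finRotate a).symm (finRotate a z))) := by
    rw [e_of _ d7 d8, Equiv.symm_apply_apply, e_z]; exact h4
  -- every other position keeps its consecutive value pair
  have g_else : ∀ k, k ≠ p → k ≠ finRotate a p → k ≠ z → k ≠ finRotate a z →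
      ρ₁ k = ρ k ∧ ρ₁ ((finRotate a).symm k) = ρ ((finRotate a).symm k) := by
    intro k k1 k2 k3 k4
    have k5 : (finRotate a).symm k ≠ p := fun h => k2 ((finRotate a).symm_apply_eq.mp h)
    have k6 : (finRotate a).symm k ≠ z := fun h => k4 ((finRotate a).symm_apply_eq.mp h)
    exact ⟨e_of k k1 k3, e_of _ k5 k6⟩
  refine ⟨ρ₁, fun k hk => ?_, ?_⟩
  · -- no new bad position, and `p` is repaired
    simp only [mem_erase, mem_filter, mem_univ, true_and] at hk ⊢
    by_cases k1 : k = p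
    · rw [k1] at hk; exact absurd g_p (not_le.mpr hk)
    by_cases k2 : k = finRotate a p
    · rw [k2] at hk; exact absurd g_sp (not_le.mpr hk)
    by_cases k3 : k = z
    · rw [k3] at hk; exact absurd g_z (not_le.mpr hk)
    by_cases k4 : k = finRotate a z
    · rw [k4] at hk; exact absurd g_sz (not_le.mpr hk)
    obtain ⟨hk1, hk2⟩ := g_else k k1 k2 k3 k4
    rw [hk1, hk2] at hk
    exact ⟨k1, hk⟩
  · -- at most four consecutive value pairs changed
    calc (univ.filter fun k : Fin a =>
            (ρ₁ k, ρ₁ ((finRotate a).symm k)) ≠ (ρ k, ρ ((finRotate a).symm k))).card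
        ≤ ({p, finRotate a p, z, finRotate a z} : Finset (Fin a)).card := by
          refine card_le_card fun k hk => ?_
          simp only [mem_filter, mem_univ, true_and] at hk
          simp only [mem_insert, mem_singleton]
          by_contra hne
          simp only [not_or] at hne
          obtain ⟨hk1, hk2⟩ := g_else k hne.1 hne.2.1 hne.2.2.1 hne.2.2.2
          exact hk (by rw [hk1, hk2])
      _ ≤ 4 := card_le_four

/-! ### The induction -/

/-- **Repair by induction on the number of bad positions.**  Under the hypotheses of
`swap_step`, every order `ρ` with at most `m` bad positions can be changed into an order
without bad positions whose consecutive value pairs differ from those of `ρ` at no more than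
`4 · #bad(ρ)` positions. -/
theorem repair {e t : ℕ} {cd : Fin a → Fin a → ℕ} (hcomm : ∀ x y : Fin a, cd x y = cd y x)
    (ha : 4 * e + 8 ≤ a)
    (hX : ∀ x : Fin a, (univ.filter fun y : Fin a => y ≠ x ∧ cd x y < t).card ≤ e) :
    ∀ (m : ℕ) (ρ : Equiv.Perm (Fin a)),
      (univ.filter fun k : Fin a => cd (ρ k) (ρ ((finRotate a).symm k)) < t).card ≤ m →
      ∃ ρ' : Equiv.Perm (Fin a),
        (∀ k : Fin a, t ≤ cd (ρ' k) (ρ' ((finRotate a).symm k))) ∧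
        (univ.filter fun k : Fin a =>
            (ρ' k, ρ' ((finRotate a).symm k)) ≠ (ρ k, ρ ((finRotate a).symm k))).card ≤
          4 * (univ.filter fun k : Fin a => cd (ρ k) (ρ ((finRotate a).symm k)) < t).card := by
  -- an order without bad positions needs no repair
  have base : ∀ ρ : Equiv.Perm (Fin a),
      (univ.filter fun k : Fin a => cd (ρ k) (ρ ((finRotate a).symm k)) < t) = ∅ →
      ∃ ρ' : Equiv.Perm (Fin a),
        (∀ k : Fin a, t ≤ cd (ρ' k) (ρ' ((finRotate a).symm k))) ∧
        (univ.filter fun k : Fin a =>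
            (ρ' k, ρ' ((finRotate a).symm k)) ≠ (ρ k, ρ ((finRotate a).symm k))).card ≤
          4 * (univ.filter fun k : Fin a => cd (ρ k) (ρ ((finRotate a).symm k)) < t).card := by
    intro ρ h
    refine ⟨ρ, fun k => ?_, ?_⟩
    · by_contra hk
      have hk' : k ∈ (univ.filter fun k : Fin a => cd (ρ k) (ρ ((finRotate a).symm k)) < t) :=
        mem_filter.mpr ⟨mem_univ _, not_le.mp hk⟩
      rw [h] at hk'
      exact notMem_empty k hk'
    · have h0 : (univ.filter fun k : Fin a =>
          (ρ k, ρ ((finRotate a).symm k)) ≠ (ρ k, ρ ((finRotate a).symm k))) = ∅ :=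
        filter_eq_empty_iff.mpr fun k _ hk => hk rfl
      rw [h0, card_empty]
      exact Nat.zero_le _
  intro m
  induction m with
  | zero =>
    intro ρ hρ
    exact base ρ (card_eq_zero.mp (Nat.le_zero.mp hρ))
  | succ m ih =>
    intro ρ hρ
    by_cases h0 : (univ.filter fun k : Fin a => cd (ρ k) (ρ ((finRotate a).symm k)) < t) = ∅
    · exact base ρ h0
    obtain ⟨p, hp⟩ := nonempty_iff_ne_empty.mpr h0
    obtain ⟨ρ₁, hsub, hch⟩ := swap_step hcomm ha hX ρ p
    have hlt :
        (univ.filter fun k : Fin a => cd (ρ₁ k) (ρ₁ ((finRotate a).symm k)) < t).card + 1 ≤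
          (univ.filter fun k : Fin a => cd (ρ k) (ρ ((finRotate a).symm k)) < t).card := by
      have h1 := card_le_card hsub
      rw [card_erase_of_mem hp] at h1
      have h2 : 0 < (univ.filter fun k : Fin a => cd (ρ k) (ρ ((finRotate a).symm k)) < t).card :=
        card_pos.mpr ⟨p, hp⟩
      omega
    obtain ⟨ρ', hgood, hch'⟩ := ih ρ₁ (by omega)
    refine ⟨ρ', hgood, ?_⟩
    have htri := card_le_card (changed_subset_union ρ' ρ₁ ρ)
    have huni := card_union_le
      (univ.filter fun k : Fin a =>
        (ρ' k, ρ' ((finRotate a).symm k)) ≠ (ρ₁ k, ρ₁ ((finRotate a).symm k)))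
      (univ.filter fun k : Fin a =>
        (ρ₁ k, ρ₁ ((finRotate a).symm k)) ≠ (ρ k, ρ ((finRotate a).symm k)))
    omega

/-- **Registered stub `stub_swapRepair`.**  `X ⊆ Fin a × Fin a`, threshold `t`, and suppose
EVERY row `x` has at most `e` rows `y ≠ x` of codegree
`codeg(x, y) = #{z : (x, z), (y, z) ∈ X} < t`, with `4e + 8 ≤ a`.  Call a position `k` of an
order `ρ ∈ Perm (Fin a)` BAD if `codeg(ρ k, ρ (k - 1)) < t` (`k - 1 := (finRotate a)⁻¹ k`).
Then every `ρ` can be changed into a `ρ'` with NO bad position such that the consecutive value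
pairs `(ρ' k, ρ' (k - 1))` differ from those of `ρ` at no more than `4 · #bad(ρ)` positions
(`repair` with the weight `cd := codeg`, symmetric by `codeg_comm`). -/
theorem stub_swapRepair :
    ∀ (a t e : ℕ) (X : Finset (Fin a × Fin a)), 4 * e + 8 ≤ a →
      (∀ x : Fin a, (Finset.univ.filter fun y : Fin a => y ≠ x ∧
          (Finset.univ.filter fun z : Fin a => (x, z) ∈ X ∧ (y, z) ∈ X).card < t).card ≤ e) →
      ∀ ρ : Equiv.Perm (Fin a), ∃ ρ' : Equiv.Perm (Fin a),
        (∀ k : Fin a, t ≤ (Finset.univ.filter fun z : Fin a =>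
            (ρ' k, z) ∈ X ∧ (ρ' ((finRotate a).symm k), z) ∈ X).card) ∧
        (Finset.univ.filter fun k : Fin a =>
            (ρ' k, ρ' ((finRotate a).symm k)) ≠ (ρ k, ρ ((finRotate a).symm k))).card ≤
          4 * (Finset.univ.filter fun k : Fin a => (Finset.univ.filter fun z : Fin a =>
            (ρ k, z) ∈ X ∧ (ρ ((finRotate a).symm k), z) ∈ X).card < t).card := by
  intro a t e X ha hX ρ
  exact repair (cd := fun x y : Fin a =>
    (Finset.univ.filter fun z : Fin a => (x, z) ∈ X ∧ (y, z) ∈ X).card)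
    (codeg_comm X) ha hX _ ρ le_rfl

end Summit.ValiantsHypothesis.ValiantsHypothesis.Theorems.DivisionGap.PerMultiplesHard.SwapRepair

end
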